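import Summits.ResolutionOfSingularities.ResolutionOfSingularities.Theorems.PurelyInseparableDim4ResConeCornerTransport
import Summits.ResolutionOfSingularities.ResolutionOfSingularities.Theorems.PurelyInseparableDim4TschirnhausChain
import HarnessLib
import HarnessLib.Audit.Tags

/-!
# Purely inseparable four-folds — LINEAR RE-FRAMING, the letter-level facts: a linear W-frame datum rides the walk
# linearly, the initial-degree law survives a clean linear re-framing, and one kernel vector is transported
# (K2(p) lane, SLICE C (C7d, part 2a), file-holder res-dim4-p-5 g3, over brick (ii) FILE E of res-dim4-p-11 g3)

[OURS · counted 0 · cell `res-dim4-pi` · K2(p) lane (desk WORDS #78 (d), #80 (d), #96 (b)) · seat res-dim4-p-5 g3.]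
Nothing here proves K2(p), `NoIsolatedTrap p p` or resolution of singularities in dimension ≥ 4 /
characteristic `p`.

* §1 LINEAR FRAMES RIDE LINEARLY: for `φ = Σ cᵢ xᵢ` the datum transported by one step of
  `FrameChange.exists_isWitnessedChain_cleanTsch` is `φ⁺ = Σ_{i ≠ j} cᵢ xᵢ` (`next_linear`): the chart letter's
  coefficient is absorbed into the translation, the others persist (`chartTransform_one_linear`, `translate_linear`);
* §2 THE INITIAL-DEGREE LAW SURVIVES a clean linear re-framing along a free letter `f ≠ a′`
  (`initialDegree_clean_tsch_linear`): `tsch` keeps degrees (p-11's `isHomogeneous_tsch`) and never lowers an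
  `x_{a′}`-exponent (`tsch_monomial`: `tsch f φ (c·x^e) = c·x^{e∖f}·(x_f + φ)^{e_f}`);
* §3 `update_mem_of_transport` — one kernel vector through the relation
  `w ∈ V′ ↔ update w f (w f + Σ cᵢ wᵢ) ∈ V` of (E4); `not_dvd_of_lt_of_lt_two_mul` (`p ∤ o` in the band).
The tail-level re-framing and the transfer theorem are `…ResConeCornerTransfer` (part 2b).
[cite: CossartJannsenSaito2020, Thm. 3.10(4), Lemma 13.2, Lemma 13.4]
bears_on: LADDER-RESOLUTION:D157-DOOR2 (res-dim4-pi · K2(p) = `RidgeBudget.NoAboveFloorTrap p p` · slice C).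
Supports stmt-ResolutionOfSingularities-16155 (helper).
-/

set_option linter.dupNamespace false -- mandated namespace of this single-conjunct summit

noncomputable section

namespace Summit.ResolutionOfSingularities.ResolutionOfSingularities.Theorems.PIDim4

namespace ResCone

open MvPolynomial Finset
open Literature.AlgebraicGeometry.Resolution
open Literature.AlgebraicGeometry.Resolution.CentreBlowup
open Literature.AlgebraicGeometry.Resolution.Hauser2010
open Literature.AlgebraicGeometry.Resolution.HauserPerlega2019
open PointBlowup (polarMap additiveSubspace direction translate)
open FrameChange (tsch)

variable {K : Type} [Field K]

/-! ## 1. Linear frames ride linearly -/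

/-- The chart map of degree `1` on a variable: `x_j ↦ 1`, `x_i ↦ x_i` (`i ≠ j`). [folklore] -/
theorem chartTransform_one_X (j i : Fin 4) :
    chartTransform 1 Finset.univ j (X i : MvPolynomial (Fin 4) K) = if i = j then 1 else X i := by
  rw [← pow_one (X i : MvPolynomial (Fin 4) K), chartTransform_X_pow]
  unfold chartExponent
  rw [degIn_univ, Finsupp.degree_single, Nat.sub_self]
  by_cases hij : i = j
  · subst hij
    rw [if_pos rfl]
    have h0 : (Finsupp.single i 1 : Fin 4 →₀ ℕ).update i 0 = 0 := by
      ext k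
      rw [Finsupp.coe_update]
      by_cases hki : k = i
      · rw [hki, Function.update_self, Finsupp.coe_zero, Pi.zero_apply]
      · rw [Function.update_of_ne hki, Finsupp.single_eq_of_ne hki, Finsupp.coe_zero, Pi.zero_apply]
    rw [h0, ← C_apply, C_1]
  · rw [if_neg hij, pow_one]
    have h1 : (Finsupp.single i 1 : Fin 4 →₀ ℕ).update j 0 = Finsupp.single i 1 := by
      ext k
      rw [Finsupp.coe_update]
      by_cases hkj : k = j
      · rw [hkj, Function.update_self, Finsupp.single_eq_of_ne (Ne.symm hij)]
      · rw [Function.update_of_ne hkj]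
    rw [h1]
    rfl

/-- The chart map of degree `1` on a linear form: `Σ cᵢ xᵢ ↦ c_j + Σ_{i ≠ j} cᵢ xᵢ`. [folklore] -/
theorem chartTransform_one_linear (j : Fin 4) (c : Fin 4 → K) :
    chartTransform 1 Finset.univ j (∑ i, C (c i) * X i : MvPolynomial (Fin 4) K) =
      C (c j) + ∑ i, C (Function.update c j 0 i) * X i := by
  rw [chartTransform_sum]
  simp_rw [chartTransform_C_mul, chartTransform_one_X]
  rw [← Finset.add_sum_erase _ _ (Finset.mem_univ j), if_pos rfl, mul_one,
    ← Finset.add_sum_erase _ (fun i => C (Function.update c j 0 i) * X i) (Finset.mem_univ j),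
    Function.update_self, C_0, zero_mul, zero_add]
  congr 1
  refine Finset.sum_congr rfl fun i hi => ?_
  rw [if_neg (Finset.ne_of_mem_erase hi), Function.update_of_ne (Finset.ne_of_mem_erase hi)]

/-- Translating an affine-linear polynomial. [folklore] -/
theorem translate_linear (b : Fin 4 → K) (c₀ : K) (c : Fin 4 → K) :
    translate b (C c₀ + ∑ i, C (c i) * X i : MvPolynomial (Fin 4) K) =
      C (c₀ + ∑ i, c i * b i) + ∑ i, C (c i) * X i := by
  unfold PointBlowup.translate
  simp only [map_add, map_sum, map_mul, aeval_C, aeval_X, MvPolynomial.algebraMap_eq]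
  rw [Finset.sum_congr rfl fun i _ => mul_add (C (c i)) (X i : MvPolynomial (Fin 4) K) (C (b i)),
    Finset.sum_add_distrib]
  ring

/-- Evaluating an affine-linear polynomial. [folklore] -/
theorem eval_linear (b : Fin 4 → K) (c₀ : K) (c : Fin 4 → K) :
    MvPolynomial.eval b (C c₀ + ∑ i, C (c i) * X i : MvPolynomial (Fin 4) K) = c₀ + ∑ i, c i * b i := by
  rw [map_add, eval_C, map_sum]
  simp_rw [map_mul, eval_C, eval_X]

/-- **LINEAR FRAMES RIDE LINEARLY**: the transport law of `FrameChange.exists_isWitnessedChain_cleanTsch` sends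
the linear datum `Σ cᵢ xᵢ` through a step in chart `j` to `Σ_{i ≠ j} cᵢ xᵢ`. [OURS] [folklore] -/
theorem next_linear (j : Fin 4) (b : Fin 4 → K) (c : Fin 4 → K) :
    translate b (chartTransform 1 Finset.univ j (∑ i, C (c i) * X i : MvPolynomial (Fin 4) K)) -
        C (MvPolynomial.eval b (chartTransform 1 Finset.univ j (∑ i, C (c i) * X i : MvPolynomial (Fin 4) K))) =
      ∑ i, C (Function.update c j 0 i) * X i := by
  rw [chartTransform_one_linear, translate_linear, eval_linear, add_sub_cancel_left]

/-! ## 2. The initial-degree law survives a clean linear re-framing -/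

/-- `tsch f φ (c·x^e) = c·x^{e∖f} · (x_f + φ)^{e_f}`. [folklore] -/
theorem tsch_monomial (f : Fin 4) (φ : MvPolynomial (Fin 4) K) (e : Fin 4 →₀ ℕ) (c : K) :
    tsch f φ (monomial e c) = monomial (e.erase f) c * (X f + φ) ^ (e f) := by
  conv_lhs => rw [← Finsupp.erase_add_single f e, monomial_add_single]
  rw [map_mul, map_pow, FrameChange.tsch_monomial_of_apply_eq_zero φ (Finsupp.erase_same), FrameChange.tsch_X_self]

/-- Every monomial of `tsch f φ F` comes from some monomial of `F`. [folklore] -/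
theorem exists_source_of_mem_support_tsch (f : Fin 4) (φ F : MvPolynomial (Fin 4) K) {E : Fin 4 →₀ ℕ}
    (hE : E ∈ (tsch f φ F).support) : ∃ e ∈ F.support, E ∈ (tsch f φ (monomial e (coeff e F))).support := by
  classical
  have h : tsch f φ F = ∑ e ∈ F.support, tsch f φ (monomial e (coeff e F)) := by
    conv_lhs => rw [F.as_sum]
    rw [map_sum]
  rw [h] at hE
  exact Finset.mem_biUnion.mp (MvPolynomial.support_sum hE)

/-- A monomial of `tsch f φ (c·x^e)` lies above `x^{e∖f}`. [folklore] -/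
theorem erase_le_of_mem_support_tsch_monomial (f : Fin 4) (φ : MvPolynomial (Fin 4) K) {e E : Fin 4 →₀ ℕ}
    {c : K} (hE : E ∈ (tsch f φ (monomial e c)).support) : e.erase f ≤ E := by
  rw [tsch_monomial, MvPolynomial.mem_support_iff, coeff_monomial_mul'] at hE
  by_contra h
  exact hE (if_neg h)

/-- A degree-`1` datum keeps the degree of every monomial. [folklore] -/
theorem degree_eq_of_mem_support_tsch_monomial (f : Fin 4) {φ : MvPolynomial (Fin 4) K} (hφ1 : φ.IsHomogeneous 1)
    {e E : Fin 4 →₀ ℕ} {c : K} (hE : E ∈ (tsch f φ (monomial e c)).support) : E.degree = e.degree := by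
  have h := FrameChange.isHomogeneous_tsch (f := f) hφ1 (isHomogeneous_monomial c (rfl : e.degree = e.degree))
  have := h (MvPolynomial.mem_support_iff.mp hE)
  rwa [weight_one_eq_degree] at this

/-- **THE INITIAL-DEGREE LAW SURVIVES A CLEAN LINEAR RE-FRAMING** along a free letter `f ≠ a′`: if every monomial
of `F` with `x_{a′}`-exponent `r_{a′}` has degree `N` (and `x^r ∣ F`), the same holds for
`clean (tsch f (Σ cᵢ xᵢ) F)`. [OURS] [folklore] -/
theorem initialDegree_clean_tsch_linear (q : ℕ) {f a' : Fin 4} (haf : a' ≠ f) (c : Fin 4 → K)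
    {F : MvPolynomial (Fin 4) K} {r : Fin 4 →₀ ℕ} {N : ℕ} (hr : ∀ e ∈ F.support, r ≤ e)
    (hP : ∀ e ∈ F.support, e a' = r a' → e.degree = N) :
    ∀ E ∈ (deletePthPowers q (tsch f (∑ i, C (c i) * X i) F)).support, E a' = r a' → E.degree = N := by
  intro E hE hEa
  have hE' := (MohAlong.mem_support_of_mem_support_deletePthPowers q hE).1
  obtain ⟨e, he, hEe⟩ := exists_source_of_mem_support_tsch f _ F hE'
  have h1 := erase_le_of_mem_support_tsch_monomial f _ hEe
  have h2 := degree_eq_of_mem_support_tsch_monomial f (FrameChange.isHomogeneous_linear c) hEe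
  have hea : e a' = r a' := by
    have h3 := h1 a'
    rw [Finsupp.erase_ne haf] at h3
    have h4 := hr e he a'
    omega
  rw [h2]
  exact hP e he hea

/-- In the isolated band `p ∤ ord₀ F`. [folklore] -/
theorem not_dvd_of_lt_of_lt_two_mul {p o : ℕ} (hpo : p < o) (ho2 : o < 2 * p) : ¬ p ∣ o := by
  rintro ⟨k, rfl⟩
  rcases Nat.lt_or_ge k 2 with hk | hk
  · interval_cases k <;> omega
  · have : p * 2 ≤ p * k := Nat.mul_le_mul_left p hk
    omega

/-! ## 3. Transport of one kernel vector -/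

/-- Transport of one kernel vector through the re-framing relation of `exists_reframed_tail`. [folklore] -/
theorem update_mem_of_transport {V V' : Submodule K (Fin 4 → K)} {f : Fin 4} {lam : Fin 4 → K} (hlam : lam f = 0)
    (hV : ∀ w : Fin 4 → K, w ∈ V' ↔ Function.update w f (w f + ∑ i, lam i * w i) ∈ V) {v : Fin 4 → K}
    (hv : v ∈ V) : Function.update v f (v f - ∑ i, lam i * v i) ∈ V' := by
  rw [hV]
  have hsum : ∑ i, lam i * Function.update v f (v f - ∑ i, lam i * v i) i = ∑ i, lam i * v i :=
    Finset.sum_congr rfl fun i _ => by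
      by_cases hif : i = f
      · rw [hif, hlam, zero_mul, zero_mul]
      · rw [Function.update_of_ne hif]
  have heq : Function.update (Function.update v f (v f - ∑ i, lam i * v i)) f
      (Function.update v f (v f - ∑ i, lam i * v i) f +
        ∑ i, lam i * Function.update v f (v f - ∑ i, lam i * v i) i) = v := by
    funext i
    by_cases hif : i = f
    · subst hif
      rw [Function.update_self, hsum, Function.update_self]
      ring
    · rw [Function.update_of_ne hif, Function.update_of_ne hif]
  rw [heq]
  exact hv


end ResCone

end Summit.ResolutionOfSingularities.ResolutionOfSingularities.Theorems.PIDim4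

end
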